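import Mathlib
import Literature.NumberTheory.Transcendental.KZCalculusProofs
import Literature.NumberTheory.Transcendental.KZLogCalculusProofs
import Literature.NumberTheory.Transcendental.KZHomotopyMoves
import Literature.NumberTheory.Transcendental.KZSemialgebraicComplex
import Summits.KontsevichZagierPeriods.KontsevichZagierPeriods.Theorems.HyperbolicBlochOffTetraSectorKernelStubAffineOrbit

/-!
# OffTetraSectorKernel (stmt-KontsevichZagierPeriods-10557), line odd-hyperbolic-ladder: stub `stub_stripToLogBand`

THE DILOGARITHM RECTANGLE IS THE UNFOLDED-LOGARITHM BAND. For real algebraic `0 ≤ α < β ≤ 1`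
the representation `R = [(α,β) × (0,1), du ds/(1 − u s)]` (value `Li₂(β) − Li₂(α)`) and the band
representation `B = [{α < u < β, 1 ≤ w ≤ 1/(1 − u)}, du dw/(u w)]` (value
`∫_α^β log(1/(1 − u)) du/u`) differ by an element of `KZ.relations`.

Proof (Kontsevich–Zagier's rule (2), two moves, plus null boundary pieces).
* The flip `(u, s) ↦ (u, 1 − s)` is the affine map with matrix `!![1, 0; 0, -1]` and translation
  `(0, 1)`, `|det| = 1`; it maps the rectangle onto itself and turns the integrand into
  `g(u, s) = 1/(1 − u(1 − s))` (`aff_orbit_of_sub_of_mem_changeOfVariablesRel`). Integrability of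
  `g` on the rectangle is read off from `R` by the change-of-variables criterion
  `MeasureTheory.integrableOn_image_iff_integrableOn_abs_det_fderiv_smul`.
* Closing the fibres `0 < s < 1` to `0 ≤ s ≤ 1` costs two null hyperplanes
  (`KZ.of_sub_of_restrict_openBand_mem_relations`).
* With `f(u) = 1/u` and `v(u) = 1/(1 − u) ≥ 1` one has `v − 1 = u/(1 − u)` and
  `g(u, s) = f(u)(v(u) − 1)/(1 + s (v(u) − 1))`, the box side of the fibrewise substitution
  `w = 1 + s (v(u) − 1)` (`KZ.of_sub_of_mem_relations_fibreSubst`), whose band side is exactly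
  `B = [{α < u < β, 1 ≤ w ≤ v(u)}, f(u)/w]`.

References: M. Kontsevich, D. Zagier, *Periods* (2001), §1.1 (`log` as `∫₁^v dw/w`), §1.2 rule (2).
-/

noncomputable section

open Set MeasureTheory
open Literature.NumberTheory.Transcendental Literature.ModelTheory.ExponentialFields

namespace Summit.KontsevichZagierPeriods.HyperbolicBloch.OffTetraSectorKernel

/-! ### The fibre bound -/

/-- The fibre bound `v(u) = 1/(1 − u)` is a `ℚ`-semialgebraic function on any `ℚ`-semialgebraic
`D ⊆ {u < 1}` (a rational function with non-vanishing denominator). [folklore] -/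
theorem stripToLogBand_isSemialgebraicFunOn_v {D : Set (Fin 1 → ℝ)} (hD : IsSemialgebraic ℚ D)
    (h1 : ∀ p ∈ D, p 0 < 1) : IsSemialgebraicFunOn ℚ D (fun p => 1 / (1 - p 0)) := by
  have hq : ∀ p ∈ D,
      MvPolynomial.aeval p (1 - MvPolynomial.X 0 : MvPolynomial (Fin 1) ℚ) ≠ 0 := fun p hp => by
    simpa using (sub_pos.mpr (h1 p hp)).ne'
  refine (isSemialgebraicFunOn_aeval_div_aeval hD 1 (1 - MvPolynomial.X 0) hq).congr
    fun p _ => ?_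
  simp

/-! ### The flip `(u, s) ↦ (u, 1 − s)` as an affine map -/

/-- The flip `(u, s) ↦ (u, 1 − s)` is the affine map with matrix `!![1, 0; 0, -1]` and
translation `(0, 1)`. [folklore] -/
theorem stripToLogBand_flip_apply (w : Fin 2 → ℝ) :
    (!![(1 : ℝ), 0; 0, -1] : Matrix (Fin 2) (Fin 2) ℝ).mulVec w + ![(0 : ℝ), 1] =
      ![w 0, 1 - w 1] := by
  ext i
  fin_cases i
  · simp [dotProduct, Fin.sum_univ_two]
  · simp [dotProduct, Fin.sum_univ_two]
    ring

/-- The matrix `!![1, 0; 0, -1]` has real-algebraic (integer) entries. [folklore] -/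
theorem stripToLogBand_flip_matrix_isAlgebraic :
    ∀ j l : Fin 2, IsAlgebraic ℚ ((!![(1 : ℝ), 0; 0, -1] : Matrix (Fin 2) (Fin 2) ℝ) j l) := by
  intro j l
  fin_cases j <;> fin_cases l
  · simpa using isAlgebraic_one
  · simpa using isAlgebraic_zero
  · simpa using isAlgebraic_zero
  · simpa using isAlgebraic_one.neg

/-- The translation `(0, 1)` has real-algebraic (integer) entries. [folklore] -/
theorem stripToLogBand_flip_vec_isAlgebraic :
    ∀ j : Fin 2, IsAlgebraic ℚ ((![(0 : ℝ), 1] : Fin 2 → ℝ) j) := by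
  intro j
  fin_cases j
  · simpa using isAlgebraic_zero
  · simpa using isAlgebraic_one

/-- `det !![1, 0; 0, -1] = -1`. [folklore] -/
theorem stripToLogBand_flip_matrix_det :
    ((!![(1 : ℝ), 0; 0, -1] : Matrix (Fin 2) (Fin 2) ℝ)).det = -1 := by
  rw [Matrix.det_fin_two_of]
  ring

/-- The box integrand identity `f(u)(v(u) − 1)/(1 + s (v(u) − 1)) = 1/(1 − u(1 − s))` for
`f(u) = 1/u`, `v(u) = 1/(1 − u)` (`u ≠ 0, 1`; then `v(u) − 1 = u/(1 − u)`). [folklore] -/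
theorem stripToLogBand_box_identity {u s : ℝ} (hu : u ≠ 0) (hu1 : 1 - u ≠ 0) :
    1 / u * (1 / (1 - u) - 1) / (1 + s * (1 / (1 - u) - 1)) = 1 / (1 - u * (1 - s)) := by
  have e1 : 1 / (1 - u) - 1 = u / (1 - u) := by
    rw [sub_eq_iff_eq_add, div_add_one hu1, add_sub_cancel]
  have e2 : 1 / u * (u / (1 - u)) = 1 / (1 - u) := by
    rw [div_mul_div_comm, one_mul, div_mul_cancel_left₀ hu, one_div]
  have e3 : 1 + s * (u / (1 - u)) = (1 - u * (1 - s)) / (1 - u) := by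
    rw [eq_div_iff hu1, add_mul, one_mul, mul_assoc, div_mul_cancel₀ _ hu1]
    ring
  rw [e1, e2, e3, div_div_div_cancel_right₀ hu1]

/-- The flip `(u, s) ↦ (u, 1 − s)` maps the rectangle `(α, β) × (0, 1)` onto itself. [folklore] -/
theorem stripToLogBand_flip_image (α β : ℝ) :
    (fun w : Fin 2 → ℝ => (![w 0, 1 - w 1] : Fin 2 → ℝ)) ''
        {w | α < w 0 ∧ w 0 < β ∧ 0 < w 1 ∧ w 1 < 1} =
      {w | α < w 0 ∧ w 0 < β ∧ 0 < w 1 ∧ w 1 < 1} := by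
  ext u
  simp only [mem_image, mem_setOf_eq]
  constructor
  · rintro ⟨w, ⟨h1, h2, h3, h4⟩, rfl⟩
    simp only [Matrix.cons_val_zero, Matrix.cons_val_one]
    exact ⟨h1, h2, by linarith, by linarith⟩
  · rintro ⟨h1, h2, h3, h4⟩
    refine ⟨![u 0, 1 - u 1], ?_, ?_⟩
    · simp only [Matrix.cons_val_zero, Matrix.cons_val_one]
      exact ⟨h1, h2, by linarith, by linarith⟩
    · ext i
      fin_cases i <;> simp

/-- **Integrability of the flipped integrand.** If `R` is a representation on the rectangle
`(α, β) × (0, 1)` with integrand `1/(1 − u s)` there, then `g(u, s) = 1/(1 − u(1 − s))` is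
absolutely integrable on the rectangle: by the change-of-variables criterion along the flip
(`|det| = 1`), `g` is integrable on the image iff `g ∘ flip = 1/(1 − u s)` is integrable on the
rectangle. [folklore] -/
theorem stripToLogBand_integrableOn_flip (R : KZ.IntegralRep 2) {α β : ℝ}
    (hR : R.domain = {w | α < w 0 ∧ w 0 < β ∧ 0 < w 1 ∧ w 1 < 1})
    (hRi : EqOn R.integrand (fun w => 1 / (1 - w 0 * w 1)) R.domain)
    (g : (Fin 2 → ℝ) → ℝ) (hg : ∀ w, g w = 1 / (1 - w 0 * (1 - w 1))) :
    IntegrableOn g {w | α < w 0 ∧ w 0 < β ∧ 0 < w 1 ∧ w 1 < 1} := by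
  set L : (Fin 2 → ℝ) →L[ℝ] (Fin 2 → ℝ) :=
    LinearMap.toContinuousLinearMap
      (Matrix.toLin' (!![(1 : ℝ), 0; 0, -1] : Matrix (Fin 2) (Fin 2) ℝ)) with hL
  have hLapply : ∀ x, L x = (!![(1 : ℝ), 0; 0, -1] : Matrix (Fin 2) (Fin 2) ℝ).mulVec x :=
    fun x => by
      rw [hL, LinearMap.coe_toContinuousLinearMap', Matrix.toLin'_apply]
  have hLdet : L.det = -1 := by
    rw [hL, LinearMap.det_toContinuousLinearMap, LinearMap.det_toLin',
      stripToLogBand_flip_matrix_det]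
  have hΦ : (fun x : Fin 2 → ℝ => (![x 0, 1 - x 1] : Fin 2 → ℝ)) = fun x => L x + ![(0 : ℝ), 1] := by
    funext x
    rw [hLapply, stripToLogBand_flip_apply]
  have hderiv : ∀ x ∈ R.domain,
      HasFDerivWithinAt (fun x : Fin 2 → ℝ => (![x 0, 1 - x 1] : Fin 2 → ℝ)) ((fun _ => L) x)
        R.domain x := fun x _ => by
    rw [hΦ]
    exact (L.hasFDerivAt.add_const _).hasFDerivWithinAt
  have hinj : InjOn (fun x : Fin 2 → ℝ => (![x 0, 1 - x 1] : Fin 2 → ℝ)) R.domain := by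
    intro x _ y _ hxy
    have h0 := congrFun hxy 0
    have h1 := congrFun hxy 1
    simp only [Matrix.cons_val_zero, Matrix.cons_val_one] at h0 h1
    ext i
    fin_cases i
    · exact h0
    · simpa using h1
  have hmeas : MeasurableSet R.domain := KZ.IntegralRep.measurableSet_domain_holds R
  have key : IntegrableOn g
      ((fun x : Fin 2 → ℝ => (![x 0, 1 - x 1] : Fin 2 → ℝ)) '' R.domain) := by
    rw [integrableOn_image_iff_integrableOn_abs_det_fderiv_smul volume hmeas hderiv hinj]
    refine R.integrableOn.congr_fun (fun x hx => ?_) hmeas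
    rw [hRi hx, hLdet, hg]
    simp only [Matrix.cons_val_zero, Matrix.cons_val_one, abs_neg, abs_one, one_smul,
      sub_sub_cancel]
  rwa [hR, stripToLogBand_flip_image] at key

/-! ### The stub -/

/-- STUB `stub_stripToLogBand` (rules (2), two moves): on the rectangle `(α,β) × (0,1)` the flip
`s ↦ 1 − s` (affine, `|det| = 1`) turns `1/(1 − u s)` into
`1/(1 − u(1 − s)) = f(u)(v(u) − 1)/(1 + s (v(u) − 1))` with `f(u) = 1/u`, `v(u) = 1/(1 − u) ≥ 1`,
which is the box form of the unfolded logarithm; the fibre substitution `w = 1 + s (v(u) − 1)`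
(`KZ.of_sub_of_mem_relations_fibreSubst`) carries it onto the band `{α < u < β, 1 ≤ w ≤ 1/(1−u)}`
with integrand `(1/u)/w` (closed versus open fibres differ by null hyperplanes).
[cite: KontsevichZagier2001, §1.2 rule (2)] -/
theorem stub_stripToLogBand :
    ∀ (α β : ℝ), IsAlgebraic ℚ α → IsAlgebraic ℚ β → 0 ≤ α → α < β → β ≤ 1 →
    ∀ (R B : KZ.IntegralRep 2),
      R.domain = {w | α < w 0 ∧ w 0 < β ∧ 0 < w 1 ∧ w 1 < 1} →
      Set.EqOn R.integrand (fun w => 1 / (1 - w 0 * w 1)) R.domain →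
      B.domain = {w | α < w 0 ∧ w 0 < β ∧ 1 ≤ w 1 ∧ w 1 ≤ 1 / (1 - w 0)} →
      Set.EqOn B.integrand (fun w => 1 / (w 0 * w 1)) B.domain →
      KZ.of R - KZ.of B ∈ KZ.relations := by
  intro α β hα hβ h0α hαβ hβ1 R B hR hRi hB hBi
  -- the base interval `D = (α, β) ⊆ (0, 1)` and the fibre bound `v(u) = 1/(1 − u) ≥ 1`
  obtain ⟨D, hD_def⟩ : ∃ D : Set (Fin 1 → ℝ), D = {p | α < p 0 ∧ p 0 < β} := ⟨_, rfl⟩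
  have hD : IsSemialgebraic ℚ D := by
    -- real algebraic constants are `ℚ`-definable
    have hU : IsSemialgebraic ℚ (univ : Set (Fin 1 → ℝ)) := isSemialgebraic_univ
    have hc : IsSemialgebraicFunOn ℚ (univ : Set (Fin 1 → ℝ)) (fun p => p 0) :=
      isSemialgebraicFunOn_apply hU 0
    have h1 := (IsSemialgebraicFunOn.sub_holds (isSemialgebraicFunOn_const_of_isAlgebraic hU hα)
      hc).isSemialgebraic_sep_neg
    have h2 := (IsSemialgebraicFunOn.sub_holds hc
      (isSemialgebraicFunOn_const_of_isAlgebraic hU hβ)).isSemialgebraic_sep_neg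
    rw [hD_def]
    convert h1.inter h2 using 1
    ext p
    simp only [mem_setOf_eq, mem_inter_iff, mem_univ, true_and, Pi.sub_apply, sub_neg]
  -- coordinates on `ℝ² = ℝ¹ × ℝ`: the base point of `w` is `w 0`, the fibre coordinate is `w 1`
  have hinit : ∀ w : Fin 2 → ℝ, Fin.init w 0 = w 0 := fun _ => rfl
  have hlast : (Fin.last 1 : Fin 2) = 1 := rfl
  have hDmem : ∀ p : Fin 1 → ℝ, p ∈ D ↔ α < p 0 ∧ p 0 < β := fun p => by rw [hD_def]; rfl
  have hDpos : ∀ p ∈ D, 0 < p 0 ∧ p 0 < 1 := fun p hp =>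
    ⟨h0α.trans_lt ((hDmem p).mp hp).1, ((hDmem p).mp hp).2.trans_le hβ1⟩
  have hv : IsSemialgebraicFunOn ℚ D (fun p => 1 / (1 - p 0)) :=
    stripToLogBand_isSemialgebraicFunOn_v hD fun p hp => (hDpos p hp).2
  have hv1 : ∀ p ∈ D, 1 ≤ 1 / (1 - p 0) := fun p hp => by
    obtain ⟨h0, h1⟩ := hDpos p hp
    rw [le_div_iff₀ (by linarith), one_mul]
    linarith
  have h0s : IsSemialgebraicFunOn ℚ D (fun _ => (0 : ℝ)) := by
    simpa using isSemialgebraicFunOn_ratCast hD 0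
  have h1s : IsSemialgebraicFunOn ℚ D (fun _ => (1 : ℝ)) := by
    simpa using isSemialgebraicFunOn_ratCast hD 1
  -- the closed box `Q = D × [0, 1]`
  have hQ : IsSemialgebraic ℚ (KZlog.band D (fun _ => (0 : ℝ)) (fun _ => 1)) :=
    KZlog.isSemialgebraic_band h0s h1s
  have hQmem : ∀ w : Fin 2 → ℝ, w ∈ KZlog.band D (fun _ => (0 : ℝ)) (fun _ => 1) ↔
      α < w 0 ∧ w 0 < β ∧ 0 ≤ w 1 ∧ w 1 ≤ 1 := fun w => by
    simp only [KZlog.mem_band, hDmem, hinit, hlast, and_assoc]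
  -- the flipped integrand `g(u, s) = 1/(1 − u(1 − s))`, positive denominator on `Q`
  obtain ⟨g, hg⟩ : ∃ g : (Fin 2 → ℝ) → ℝ, ∀ w, g w = 1 / (1 - w 0 * (1 - w 1)) :=
    ⟨_, fun _ => rfl⟩
  have hden : ∀ w : Fin 2 → ℝ, α < w 0 → w 0 < β → 0 ≤ w 1 → w 1 ≤ 1 →
      0 < 1 - w 0 * (1 - w 1) := fun w h1 h2 h3 h4 => by
    have hw0 : 0 < w 0 := h0α.trans_lt h1
    have hw0' : w 0 < 1 := h2.trans_le hβ1
    nlinarith [mul_nonneg hw0.le h3]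
  have hgQ : IsSemialgebraicFunOn ℚ (KZlog.band D (fun _ => (0 : ℝ)) (fun _ => 1)) g := by
    have hq : ∀ w ∈ KZlog.band D (fun _ => (0 : ℝ)) (fun _ => 1),
        MvPolynomial.aeval w
          (1 - MvPolynomial.X 0 * (1 - MvPolynomial.X 1) : MvPolynomial (Fin 2) ℚ) ≠ 0 := by
      intro w hw
      obtain ⟨h1, h2, h3, h4⟩ := (hQmem w).mp hw
      simpa using (hden w h1 h2 h3 h4).ne'
    refine (isSemialgebraicFunOn_aeval_div_aeval hQ 1 _ hq).congr fun w _ => ?_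
    simp [hg]
  have hgI : IntegrableOn g (KZlog.band D (fun _ => (0 : ℝ)) (fun _ => 1)) := by
    have hI : IntegrableOn g {w | α < w 0 ∧ w 0 < β ∧ 0 < w 1 ∧ w 1 < 1} :=
      stripToLogBand_integrableOn_flip R hR hRi g hg
    have hnull : volume ({z : Fin 2 → ℝ | z (Fin.last 1) = 0} ∪
        {z : Fin 2 → ℝ | z (Fin.last 1) = 1}) = 0 :=
      measure_union_null (KZ.volume_setOf_last_eq_zero 0) (KZ.volume_setOf_last_eq_zero 1)
    refine (hI.union (IntegrableOn.of_measure_zero hnull)).mono_set fun w hw => ?_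
    obtain ⟨h1, h2, h3, h4⟩ := (hQmem w).mp hw
    rcases h3.lt_or_eq with h3 | h3
    · rcases h4.lt_or_eq with h4 | h4
      · exact Or.inl ⟨h1, h2, h3, h4⟩
      · exact Or.inr (Or.inr h4)
    · exact Or.inr (Or.inl h3.symm)
  -- the box representation `R₂ = [Q, g]`
  obtain ⟨R₂, hR₂d, hR₂i⟩ : ∃ R₂ : KZ.IntegralRep 2,
      R₂.domain = KZlog.band D (fun _ => (0 : ℝ)) (fun _ => 1) ∧ R₂.integrand = g :=
    ⟨⟨_, g, hQ, hgQ, hgI⟩, rfl, rfl⟩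
  -- opening the fibres: `R'` = `R₂` restricted to `D × (0, 1)`, i.e. to the rectangle
  obtain ⟨R', hR'd, hR'i, hopen⟩ := KZ.of_sub_of_restrict_openBand_mem_relations h0s h1s R₂ hR₂d
  have hR'd' : R'.domain = {w | α < w 0 ∧ w 0 < β ∧ 0 < w 1 ∧ w 1 < 1} := by
    rw [hR'd]
    ext w
    simp only [mem_setOf_eq, hDmem, hinit, hlast, and_assoc]
  -- move (i): the flip `(u, s) ↦ (u, 1 − s)` carries `R` onto `R'` (rule (2))
  have hflip : KZ.of R - KZ.of R' ∈ KZ.relations := by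
    refine KZ.changeOfVariablesRel_subset_relations
      (aff_orbit_of_sub_of_mem_changeOfVariablesRel (!![(1 : ℝ), 0; 0, -1]) ![(0 : ℝ), 1]
        stripToLogBand_flip_matrix_isAlgebraic stripToLogBand_flip_vec_isAlgebraic
        (by rw [stripToLogBand_flip_matrix_det]; norm_num) R R' ?_ ?_)
    · rw [hR'd', hR,
        show (fun w : Fin 2 → ℝ =>
            (!![(1 : ℝ), 0; 0, -1] : Matrix (Fin 2) (Fin 2) ℝ).mulVec w + ![(0 : ℝ), 1]) =
          fun w => ![w 0, 1 - w 1] from funext stripToLogBand_flip_apply]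
      exact (stripToLogBand_flip_image α β).symm
    · intro w hw
      rw [hRi hw, hR'i, hR₂i, stripToLogBand_flip_apply, stripToLogBand_flip_matrix_det, hg]
      simp only [Matrix.cons_val_zero, Matrix.cons_val_one, abs_neg, abs_one, mul_one,
        sub_sub_cancel]
  -- move (ii): the fibrewise substitution `w = 1 + s (v(u) − 1)` between `B` and `R₂`
  have hsubst : KZ.of B - KZ.of R₂ ∈ KZ.relations := by
    refine KZ.of_sub_of_mem_relations_fibreSubst (f := fun p : Fin 1 → ℝ => 1 / p 0) hD hv hv1
      B R₂ ?_ ?_ hR₂d ?_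
    · rw [hB]
      ext w
      simp only [mem_setOf_eq, KZlog.mem_band, hDmem, hinit, hlast, and_assoc]
    · intro w hw
      rw [hBi hw]
      simp only [hinit, hlast]
      ring
    · intro w hw
      rw [hR₂d] at hw
      obtain ⟨h1, h2, -, -⟩ := (hQmem w).mp hw
      have hw0 : (0 : ℝ) < w 0 := h0α.trans_lt h1
      have hw1 : (0 : ℝ) < 1 - w 0 := by linarith [h2.trans_le hβ1]
      rw [hR₂i, hg]
      simp only [hinit, hlast]
      exact (stripToLogBand_box_identity hw0.ne' hw1.ne').symm
  -- bookkeeping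
  have : KZ.of R - KZ.of B =
      (KZ.of R - KZ.of R') - (KZ.of R₂ - KZ.of R') - (KZ.of B - KZ.of R₂) := by abel
  rw [this]
  exact KZ.relations.sub_mem (KZ.relations.sub_mem hflip hopen) hsubst

end Summit.KontsevichZagierPeriods.HyperbolicBloch.OffTetraSectorKernel

end
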